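import Summits.RiemannHypothesis.RiemannHypothesis.Theorems.SemilocalNegCertFortyOneKinked1886
import HarnessLib

/-!
# Semi-local threshold of the `{∞,2,…,41}` form, negative side: `a*({2,…,41}) ≤ 1931 / 1024 = 1.8857421875` — the wall `q = 43` from a KINKED (piecewise-cubic) witness with slope breaks at the prime-atom images (part 10/16: the kernel facts piece 132 … piece 146 of 205 (imports part 1 only))

Cell `rh-explicit` (HOME `run/shared/lean/pub/rh-explicit/`), seat cc-s2-9 gen2 (HUMAN RULING D-0074 (D5) WEIL data engine; LADDER-RH column WEIL, rung DATA → W-P(P2);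
pipeline = cc-s2-4 gen8/gen11's piecewise-witness layer `SemilocalPiecewise{Witness,Increment,IncrementSum,Cert}.lean` + their float finder, every number
re-derived by an independent second engine E2 before filing; gen0's rows: `SemilocalNegCert{ThirteenKinked1423,SeventeenKinked1478,NineteenKinked1573,TwentyThreeKinked1690,TwentyNineKinked1723}*`).
HONEST FRAMING: RH-FREE theorems about the tree's `weilSemilocalThreshold S` of a TRUNCATED Weil form (finitely many places); nothing here bears on the
truth of RH; the lower clause `(log q)/2 ≤ a*(S_q)` at all primes IS RH and is untouched; the SIGN of `δ*(43)` is not claimed.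

KINKED row for the wall `q = 43` (`S = {2,…,41}`): at `b = 1931 / 1024 = 1.8857421875 ≈ a*(S_43) + 0.0051` (DATA, two engines, cc-s2-6/cc-s2-3: `a*(S_43) = 1.88065625`)
the polynomial × indicator class is far from negative (tree row `61/32`, `SemilocalNegCertUptoFortyOne`, `δ*(43) ≤ 0.0256`), whereas an odd piecewise cubic with slope breaks at the images
`|b − log n|` (rounded to `/1024`) of the atoms `n ∈ {2,3,5,7,11,13,17,19,23,29,31,37,41}` (the thirteen PRIME atoms; images of 4, 8, 9, 16, 25, 27, 32 dropped — all twenty kinks: λ_min = −1.03·10⁻², primes + 4 + 9: −3.72·10⁻³; kit j253132) is negative by `1.993e-03·‖G‖²`.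
Instance: `S = {2, 3, 5, 7, 11, 13, 17, 19, 23, 29, 31, 37, 41}`, `N = 45` (atom table `atomsUptoFortyOne` / `atomsEnclose_UptoFortyOne` of `SemilocalNegCertUptoFortyOne.lean`), 14 pieces of degree ≤ 3, 205 `t`-pieces;
TWO ENGINES on the witness before the kernel: cc-s2-4's float finder `λ_min = -1.9927e-03` and the seat's exact-in-`x` decimal engine E2 `R = -1.9927e-03` (no polar credit);
the exact kernel margin is the certificate's own rational arithmetic (farm report).  ⇒ **`a*({2,…,41}) ≤ 1931 / 1024`, `δ*(43) < 0.005143`** (was `0.0256`).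
No data is trusted: every bound is a `decide +kernel` fact.  Folklore throughout.
-/

set_option autoImplicit false
set_option linter.dupNamespace false  -- the mandated namespace repeats `RiemannHypothesis`
set_option Elab.async false  -- serialise the kernel facts: in parallel they exhaust the node's per-process heap (cc-s2-4 gen11, CC4-LEAN §16.10)

noncomputable section

open Complex Filter Set MeasureTheory Topology
open scoped Real

namespace Summit.RiemannHypothesis.RiemannHypothesis.Theorems.SemilocalPolyWitness

open MeasureTheory Set Finset Real
open Literature.NumberTheory.LFunctions
open Summit.RiemannHypothesis.RiemannHypothesis.Theorems.MotivicDoor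
open Summit.RiemannHypothesis.RiemannHypothesis.Theorems.MotivicDoor.SemilocalThreshold
open Summit.RiemannHypothesis.RiemannHypothesis.Theorems.MotivicDoor.SemilocalMarkov
open LQ

set_option maxHeartbeats 0 in
/-- kernel fact: piece `132` of `certFortyOneKinked1886`. -/
theorem check_FortyOneKinked1886_piece132 : certFortyOneKinked1886.checkPiecePW 132 = true := by
  decide +kernel

set_option maxHeartbeats 0 in
/-- kernel fact: piece `133` of `certFortyOneKinked1886`. -/
theorem check_FortyOneKinked1886_piece133 : certFortyOneKinked1886.checkPiecePW 133 = true := by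
  decide +kernel

set_option maxHeartbeats 0 in
/-- kernel fact: piece `134` of `certFortyOneKinked1886`. -/
theorem check_FortyOneKinked1886_piece134 : certFortyOneKinked1886.checkPiecePW 134 = true := by
  decide +kernel

set_option maxHeartbeats 0 in
/-- kernel fact: piece `135` of `certFortyOneKinked1886`. -/
theorem check_FortyOneKinked1886_piece135 : certFortyOneKinked1886.checkPiecePW 135 = true := by
  decide +kernel

set_option maxHeartbeats 0 in
/-- kernel fact: piece `136` of `certFortyOneKinked1886`. -/
theorem check_FortyOneKinked1886_piece136 : certFortyOneKinked1886.checkPiecePW 136 = true := by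
  decide +kernel

set_option maxHeartbeats 0 in
/-- kernel fact: piece `137` of `certFortyOneKinked1886`. -/
theorem check_FortyOneKinked1886_piece137 : certFortyOneKinked1886.checkPiecePW 137 = true := by
  decide +kernel

set_option maxHeartbeats 0 in
/-- kernel fact: piece `138` of `certFortyOneKinked1886`. -/
theorem check_FortyOneKinked1886_piece138 : certFortyOneKinked1886.checkPiecePW 138 = true := by
  decide +kernel

set_option maxHeartbeats 0 in
/-- kernel fact: piece `139` of `certFortyOneKinked1886`. -/
theorem check_FortyOneKinked1886_piece139 : certFortyOneKinked1886.checkPiecePW 139 = true := by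
  decide +kernel

set_option maxHeartbeats 0 in
/-- kernel fact: piece `140` of `certFortyOneKinked1886`. -/
theorem check_FortyOneKinked1886_piece140 : certFortyOneKinked1886.checkPiecePW 140 = true := by
  decide +kernel

set_option maxHeartbeats 0 in
/-- kernel fact: piece `141` of `certFortyOneKinked1886`. -/
theorem check_FortyOneKinked1886_piece141 : certFortyOneKinked1886.checkPiecePW 141 = true := by
  decide +kernel

set_option maxHeartbeats 0 in
/-- kernel fact: piece `142` of `certFortyOneKinked1886`. -/
theorem check_FortyOneKinked1886_piece142 : certFortyOneKinked1886.checkPiecePW 142 = true := by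
  decide +kernel

set_option maxHeartbeats 0 in
/-- kernel fact: piece `143` of `certFortyOneKinked1886`. -/
theorem check_FortyOneKinked1886_piece143 : certFortyOneKinked1886.checkPiecePW 143 = true := by
  decide +kernel

set_option maxHeartbeats 0 in
/-- kernel fact: piece `144` of `certFortyOneKinked1886`. -/
theorem check_FortyOneKinked1886_piece144 : certFortyOneKinked1886.checkPiecePW 144 = true := by
  decide +kernel

set_option maxHeartbeats 0 in
/-- kernel fact: piece `145` of `certFortyOneKinked1886`. -/
theorem check_FortyOneKinked1886_piece145 : certFortyOneKinked1886.checkPiecePW 145 = true := by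
  decide +kernel

set_option maxHeartbeats 0 in
/-- kernel fact: piece `146` of `certFortyOneKinked1886`. -/
theorem check_FortyOneKinked1886_piece146 : certFortyOneKinked1886.checkPiecePW 146 = true := by
  decide +kernel

end Summit.RiemannHypothesis.RiemannHypothesis.Theorems.SemilocalPolyWitness

end
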